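import Summits.HodgeConjecture.HodgeConjecture.Theorems.LimitExtensionMidSmoothNearGoodFibre
import Literature.AlgebraicGeometry.HodgeTheory.QuasiProjectiveOfAffine
import Literature.AlgebraicGeometry.HodgeTheory.IsoTransport
import Literature.AlgebraicGeometry.HodgeTheory.DivisorClassesFiniteEtaleBaseChange
import Mathlib.Topology.JacobsonSpace

/-!
# Route LimitExtension — crux `LimitExtensionMid` (stmt-HodgeConjecture-2995), line `birth`: STUB F1 `stub_fixedPartOnPuncturedCurve`

The registered stub `stub_fixedPartOnPuncturedCurve` of the skeleton
`Cruxes/LimitExtensionMid/Lines/birth.lean`: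

> `charlesSchnell_hodgeClass_of_flat → FixedPartOnPuncturedCurve` — in the setting of the crux
> (`T` a smooth irreducible curve, `f : W ⟶ T` flat and proper, fibres over `t ≠ t₀` smooth
> `2k`-dimensional hypersurfaces, `B ∈ H^{2k}(W(ℂ); ℂ)` rational), Hodge type `(k,k)` of
> `B|_{W_{t₁}}` at ONE `t₁ ≠ t₀` propagates to every `t ≠ t₀`,

proved from the named fact `HodgeTheory.charlesSchnell_hodgeClass_of_flat` (Charles–Schnell,
*Notes on absolute Hodge classes*, Prop. 11.3.5 (1): a flat rational section of `R^{2p}π_*ℚ` over a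
smooth connected quasi-projective base which is a Hodge class at one point is a Hodge class
everywhere), taken as a HYPOTHESIS exactly as registered — this file does not discharge the fact.

## Proof

The base `T` is an arbitrary smooth irreducible `ℂ`-scheme of dimension one (not assumed separated
or quasi-compact), and the total space `W` is not assumed quasi-projective; the named fact wants a
smooth projective FAMILY over a smooth CONNECTED QUASI-PROJECTIVE base. We therefore work on small
affine pieces of the punctured curve and chain:

1. **Good affine pieces** (`Theorems.exists_isAffineOpen_isSmoothProjectiveFamily`, sibling file
   `LimitExtensionMidSmoothNearGoodFibre`): every complex point `t ≠ t₀` has an affine open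
   neighbourhood `V ⊆ T ∖ {t₀}` over which the restricted family `W ×_T V ⟶ V` is a smooth projective
   family of relative dimension `2k` (fibre criterion of smoothness EGA IV₄ 17.5.1 for the flat
   proper `f`, the relative dimension being read off the smooth projective fibres).
2. **One step inside a good affine piece** (`isOfHodgeType_map_fiberι_of_charlesSchnell_of_affineOpen`):
   `V` is quasi-projective (`IsQuasiProjectiveOver.of_isAffine`), smooth, irreducible, so `V(ℂ)` is
   connected (SGA1 XII Prop. 2.4, the tree's `connectedSpace_complexPoints_of_irreducibleSpace`);
   the global class `pr_W^* B` on `W ×_T V` gives a continuous rational section `u ↦ (u, B|_{W_u})`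
   of the espace étalé of `R^{2k}(f_V)_*ℂ` (`continuous_globalSection`, `IsRationalClass.map`); the
   named fact moves the Hodge type from one complex point of `V` to any other, and the fibres of the
   restricted family are those of `f` (`map_fiberι_familyPullback`, `isOfHodgeType_map_iff_of_iso`).
3. **Chain** (`fixedPartOnPuncturedCurve_of_charlesSchnell`): good affine pieces `V₁ ∋ t₁`, `V₂ ∋ t`
   meet (`T` irreducible) in an open set containing a closed point (Jacobson), which underlies a
   complex point `u` (Nullstellensatz, `ComplexPoints.equivClosedPoints`); go `t₁ → u → t`.

`stub_fixedPartOnPuncturedCurve` restates the result in the registered binder shape. No definition,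
no named fact, no `sorry`; `HC_CM` plays no role here; nothing here proves a case of the Hodge
conjecture.

References: [CharlesSchnell2014Notes] F. Charles, C. Schnell, Notes on absolute Hodge classes
(2014), Prop. 11.3.5 (1), Thm. 11.3.4; [DeligneHodgeII1971] P. Deligne, Théorie de Hodge II, Thm.
4.1.1, Cor. 4.1.2, (4.1.3.1); [EGAIV4] Thm. 17.5.1; [SGA1] Exp. XII Prop. 2.4.
-/

noncomputable section

-- mandated namespace of this single-conjunct summit; see the sibling `LimitExtension*` files
set_option linter.dupNamespace false

open CategoryTheory AlgebraicGeometry TopologicalSpace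
open Literature.AlgebraicGeometry.Motives Literature.AlgebraicGeometry.HodgeTheory

namespace Summit.HodgeConjecture.HodgeConjecture.Theorems

/-! ### Small tools on complex points -/

section Points

variable {T : SchemeOver ℂ}

/-- Complex points of a `ℂ`-scheme locally of finite type with the same underlying point are equal
(Nullstellensatz, `ComplexPoints.equivClosedPoints`). [folklore] -/
theorem complexPoints_eq_of_pt_eq [LocallyOfFiniteType T.hom] {a b : ComplexPoints T}
    (h : a.pt = b.pt) : a = b :=
  (ComplexPoints.equivClosedPoints T).injective (Subtype.ext h)

/-- A closed point of a `ℂ`-scheme locally of finite type underlies a complex point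
(Nullstellensatz, `ComplexPoints.equivClosedPoints`). [folklore] -/
theorem exists_complexPoints_pt_eq [LocallyOfFiniteType T.hom] {y : T.left}
    (hy : y ∈ closedPoints T.left) : ∃ u : ComplexPoints T, u.pt = y := by
  obtain ⟨u, hu⟩ := (ComplexPoints.equivClosedPoints T).surjective ⟨y, hy⟩
  exact ⟨u, congrArg Subtype.val hu⟩

end Points

/-! ### One step inside a good affine piece of the base -/

section Step

variable {n p : ℕ} {T W : SchemeOver ℂ} (f : W ⟶ T)

/-- **One step of the fixed part theorem inside a good affine open.** Let `f : W ⟶ T` be a morphism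
over a smooth irreducible `ℂ`-scheme `T`, `B ∈ H²ᵖ(W(ℂ); ℂ)` a rational class, and `V ⊆ T` an affine
open over which the restricted family `W ×_T V ⟶ V` is a smooth projective family of relative
dimension `n`. Granted `charlesSchnell_hodgeClass_of_flat`, if `B|_{W_a}` is of type `(p,p)` for one
complex point `a` of `V` then `B|_{W_b}` is of type `(p,p)` for every complex point `b` of `V`: the fact
applies to the continuous rational section `u ↦ (u, B|_{W_u})` of the restricted family over the
smooth, connected (`V` irreducible), quasi-projective (`V` affine) base `V`, and the fibres of the
restricted family are those of `f`. [cite: CharlesSchnell2014Notes, Prop. 11.3.5 (1)] -/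
theorem isOfHodgeType_map_fiberι_of_charlesSchnell_of_affineOpen
    (hCS : charlesSchnell_hodgeClass_of_flat) [Smooth T.hom] [IrreducibleSpace T.left]
    (B : complexBetti W (2 * p)) (hB : IsRationalClass B) (V : T.left.Opens) (hV : IsAffineOpen V)
    (hfam : IsSmoothProjectiveFamily (familyPullback.snd f (openSubschemeOverι T V)) n)
    {a b : ComplexPoints T} (ha : a.pt ∈ V) (hb : b.pt ∈ V)
    (hHa : IsOfHodgeType n (fiberOver f a) (2 * p) p p (complexBetti.map (fiberι f a) (2 * p) B)) :
    IsOfHodgeType n (fiberOver f b) (2 * p) p p (complexBetti.map (fiberι f b) (2 * p) B) := by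
  -- the affine open `V` as a smooth irreducible affine `ℂ`-scheme `g : V ⟶ T`
  set g : openSubschemeOver T V ⟶ T := openSubschemeOverι T V with hg
  haveI : IsOpenImmersion g.left := inferInstanceAs (IsOpenImmersion V.ι)
  haveI : IsAffine (openSubschemeOver T V).left := hV
  haveI : Smooth (openSubschemeOver T V).hom := by
    change Smooth (V.ι ≫ T.hom)
    infer_instance
  haveI : LocallyOfFiniteType (openSubschemeOver T V).hom := inferInstance
  haveI : IrreducibleSpace (openSubschemeOver T V).left := by
    change IrreducibleSpace V
    exact isIrreducible_iff_irreducibleSpace.mp ⟨⟨a.pt, ha⟩,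
      (PreirreducibleSpace.isPreirreducible_univ (X := T.left)).open_subset V.isOpen
        (Set.subset_univ _)⟩
  haveI : ConnectedSpace (ComplexPoints (openSubschemeOver T V)) :=
    connectedSpace_complexPoints_of_irreducibleSpace _
  have hQP : IsQuasiProjectiveOver (openSubschemeOver T V) := IsQuasiProjectiveOver.of_isAffine _
  -- lift `a`, `b` to `V`
  have hrange : Set.range (AlgPoints.map (L := ℂ) g) = {P | P.pt ∈ V} := by
    rw [AlgPoints.range_map_of_isOpenImmersion_holds]
    ext P
    change P.pt ∈ V.ι.opensRange ↔ P.pt ∈ V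
    rw [Scheme.Opens.opensRange_ι]
  obtain ⟨a', rfl⟩ : a ∈ Set.range (AlgPoints.map (L := ℂ) g) := by rw [hrange]; exact ha
  obtain ⟨b', rfl⟩ : b ∈ Set.range (AlgPoints.map (L := ℂ) g) := by rw [hrange]; exact hb
  -- the continuous rational section `u ↦ (u, B|_{W_u})` of the restricted family
  set B' : complexBetti (familyPullback f g) (2 * p) :=
    complexBetti.map (familyPullback.fst f g) (2 * p) B with hB'
  set σ : ComplexPoints (openSubschemeOver T V) → FiberClass (familyPullback.snd f g) (2 * p) :=
    globalSection (familyPullback.snd f g) (2 * p) B' with hσ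
  have hσc : Continuous σ := continuous_globalSection _ _ _
  have hpt : ∀ u, (σ u).pt = u := fun u => rfl
  have hrat : ∀ u, IsRationalClass (σ u).cls := fun u => (hB.map _).map _
  -- the anchor
  have hanchor : σ a' ∈ locusOfHodgeClasses (familyPullback.snd f g) n p := by
    rw [mem_locusOfHodgeClasses_iff]
    refine ⟨hrat a', ?_⟩
    change IsOfHodgeType n (fiberOver (familyPullback.snd f g) a') (2 * p) p p
      (complexBetti.map (fiberι (familyPullback.snd f g) a') (2 * p) B')
    rw [hB', map_fiberι_familyPullback, isOfHodgeType_map_iff_of_iso]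
    exact hHa
  -- the named fact, and back to the fibre of `f`
  have hb' := ((mem_locusOfHodgeClasses_iff (σ b')).1
    (hCS _ _ (familyPullback.snd f g) n p hfam hQP inferInstance inferInstance σ hσc hpt hrat a'
      hanchor b')).2
  change IsOfHodgeType n (fiberOver (familyPullback.snd f g) b') (2 * p) p p
    (complexBetti.map (fiberι (familyPullback.snd f g) b') (2 * p) B') at hb'
  rwa [hB', map_fiberι_familyPullback, isOfHodgeType_map_iff_of_iso] at hb'

end Step

/-! ### The fixed part theorem on the punctured curve of a degeneration -/

/-- **Theorem of the fixed part on the punctured curve of a hypersurface degeneration, from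
Charles–Schnell Prop. 11.3.5 (1).** Let `T` be a smooth irreducible `ℂ`-scheme of relative dimension
one, `f : W ⟶ T` flat and proper, `t₀ ∈ T(ℂ)`, such that every fibre `W_t`, `t ≠ t₀`, is a smooth
`2k`-dimensional hypersurface, and `B ∈ H^{2k}(W(ℂ); ℂ)` a rational class. Granted
`charlesSchnell_hodgeClass_of_flat`, if `B|_{W_{t₁}}` is of type `(k,k)` for one `t₁ ≠ t₀` then
`B|_{W_t}` is of type `(k,k)` for every `t ≠ t₀`. Proof: good affine pieces `V₁ ∋ pt t₁`, `V₂ ∋ pt t`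
of the punctured curve over which `f` restricts to a smooth projective family
(`exists_isAffineOpen_isSmoothProjectiveFamily`); they meet in a closed point underlying a complex
point `u`; two steps `isOfHodgeType_map_fiberι_of_charlesSchnell_of_affineOpen`.
[cite: CharlesSchnell2014Notes, Prop. 11.3.5 (1)] [cite: DeligneHodgeII1971, (4.1.3.1)] -/
theorem fixedPartOnPuncturedCurve_of_charlesSchnell (hCS : charlesSchnell_hodgeClass_of_flat)
    ⦃k : ℕ⦄ ⦃T W : SchemeOver ℂ⦄ (f : W ⟶ T) (t₀ : ComplexPoints T) (B : complexBetti W (2 * k))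
    (hT : SmoothOfRelativeDimension 1 T.hom) (hirr : IrreducibleSpace T.left) (hfl : Flat f.left)
    (hpr : IsProper f.left) (hB : IsRationalClass B)
    (hhyp : ∀ t : ComplexPoints T, t ≠ t₀ → ∃ d : ℕ, IsSmoothHypersurface (2 * k) d (fiberOver f t))
    (t₁ : ComplexPoints T) (ht₁ : t₁ ≠ t₀)
    (hH₁ : IsOfHodgeType (2 * k) (fiberOver f t₁) (2 * k) k k (complexBetti.map (fiberι f t₁) (2 * k) B))
    (t : ComplexPoints T) (ht : t ≠ t₀) :
    IsOfHodgeType (2 * k) (fiberOver f t) (2 * k) k k (complexBetti.map (fiberι f t) (2 * k) B) := by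
  haveI := hT
  haveI := hirr
  haveI := hfl
  haveI := hpr
  haveI : Smooth T.hom := SmoothOfRelativeDimension.smooth 1 T.hom
  haveI : LocallyOfFiniteType T.hom := inferInstance
  haveI : JacobsonSpace T.left := LocallyOfFiniteType.jacobsonSpace T.hom
  -- the punctured curve `O = T ∖ {pt t₀}` and its good fibres
  set O : T.left.Opens := ⟨{t₀.pt}ᶜ, (ComplexPoints.isClosed_pt t₀).isOpen_compl⟩ with hO
  have hmemO : ∀ b : ComplexPoints T, b ≠ t₀ → b.pt ∈ O :=
    fun b hb h => hb (complexPoints_eq_of_pt_eq h)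
  have hgood : ∀ b : ComplexPoints T, b.pt ∈ O → IsSmoothProjective (2 * k) (fiberOver f b) := by
    intro b hb
    have hne : b ≠ t₀ := by
      rintro rfl
      exact hb rfl
    obtain ⟨d, hd⟩ := hhyp b hne
    exact hd.1
  -- good affine pieces around `t₁` and `t`
  obtain ⟨V₁, hV₁, h₁V₁, -, hfam₁⟩ :=
    exists_isAffineOpen_isSmoothProjectiveFamily f O hgood t₁ (hmemO t₁ ht₁)
  obtain ⟨V₂, hV₂, h₂V₂, -, hfam₂⟩ :=
    exists_isAffineOpen_isSmoothProjectiveFamily f O hgood t (hmemO t ht)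
  -- they meet in a closed point, which underlies a complex point `u`
  have hne : ((V₁ : Set T.left) ∩ (V₂ : Set T.left)).Nonempty := by
    obtain ⟨x, -, hx⟩ := (PreirreducibleSpace.isPreirreducible_univ (X := T.left)) _ _ V₁.isOpen
      V₂.isOpen ⟨t₁.pt, Set.mem_univ _, h₁V₁⟩ ⟨t.pt, Set.mem_univ _, h₂V₂⟩
    exact ⟨x, hx⟩
  obtain ⟨y, ⟨hy₁, hy₂⟩, hyc⟩ :=
    nonempty_inter_closedPoints hne (V₁.isOpen.inter V₂.isOpen).isLocallyClosed
  obtain ⟨u, rfl⟩ := exists_complexPoints_pt_eq hyc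
  -- `t₁ → u` inside `V₁`, then `u → t` inside `V₂`
  exact isOfHodgeType_map_fiberι_of_charlesSchnell_of_affineOpen f hCS B hB V₂ hV₂ hfam₂ hy₂ h₂V₂
    (isOfHodgeType_map_fiberι_of_charlesSchnell_of_affineOpen f hCS B hB V₁ hV₁ hfam₁ h₁V₁ hy₁ hH₁)

/-- **STUB F1 of crux `LimitExtensionMid` (stmt-HodgeConjecture-2995), line `birth`, in its
registered shape** `charlesSchnell_hodgeClass_of_flat → FixedPartOnPuncturedCurve` (the second
member spelled out, as registered): the theorem of the fixed part on the punctured curve of a flat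
proper hypersurface degeneration, from Charles–Schnell Prop. 11.3.5 (1).
[cite: CharlesSchnell2014Notes, Prop. 11.3.5 (1)] [cite: DeligneHodgeII1971, Thm. 4.1.1, Cor. 4.1.2] -/
theorem stub_fixedPartOnPuncturedCurve :
    charlesSchnell_hodgeClass_of_flat →
    ∀ ⦃k : ℕ⦄ ⦃T W : SchemeOver ℂ⦄ (f : W ⟶ T) (t₀ : ComplexPoints T) (B : complexBetti W (2 * k)),
      SmoothOfRelativeDimension 1 T.hom → IrreducibleSpace T.left → Flat f.left → IsProper f.left →
      IsRationalClass B →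
      (∀ t : ComplexPoints T, t ≠ t₀ → ∃ d : ℕ, IsSmoothHypersurface (2 * k) d (fiberOver f t)) →
      ∀ t₁ : ComplexPoints T, t₁ ≠ t₀ →
        IsOfHodgeType (2 * k) (fiberOver f t₁) (2 * k) k k (complexBetti.map (fiberι f t₁) (2 * k) B) →
        ∀ t : ComplexPoints T, t ≠ t₀ →
          IsOfHodgeType (2 * k) (fiberOver f t) (2 * k) k k
            (complexBetti.map (fiberι f t) (2 * k) B) :=
  fun hCS _ _ _ f t₀ B hT hirr hfl hpr hB hhyp t₁ ht₁ hH₁ t ht =>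
    fixedPartOnPuncturedCurve_of_charlesSchnell hCS f t₀ B hT hirr hfl hpr hB hhyp t₁ ht₁ hH₁ t ht

end Summit.HodgeConjecture.HodgeConjecture.Theorems

end
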